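import Summits.QuantumFields.YangMills.Theorems.LangevinControlUVFemtoCurvatureTwoPointRateFree
import Summits.QuantumFields.YangMills.Theorems.LangevinControlUVFemtoCurvatureTwoPointStrictRPAxisPositive

/-!
# Crux `FemtoCurvatureTwoPoint` (stmt-QuantumFields-9363, route `LangevinControlUV`):
# the typed item is EQUIVALENT to its two open fixed-torus stubs

Support file of the line `generic-step-gamma-encoding` (`--supports stmt-QuantumFields-9363`), item
prover seat c6. It closes the logical circle around the typed support item
`FemtoCurvatureTwoPoint` inside `Theorems/` (so far the necessary half lived only in the crux
workfile `Cruxes/FemtoCurvatureTwoPoint/Disproof.lean`, `PackageWith.esfb`, which is not importable):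

* `shapeFree_of_cruxAt` — the converse of the landed `RateFree.cruxAt_of_shapeFree`: at fixed data
  `(G, r)` ANY witness `(a, Γ, β₀, ℓ₀, c, C)` of the crux body forces the EVENTUAL SHAPE-FREE BOUNDS
  with the one constant `K = C / c` — strict positivity of the reference axis covariance,
  comparability of the axis covariances across tori at equal `(β, n)`, and domination of every
  plaquette pair at torus distance `n` by the axis covariance at separation `n`; no unit map, no shape
  function, no rate (port of the disprover's dissection: every torus is eventually femto because
  `a → 0`, and the shared `Γ`-argument `n · a(β)` is the only coupling between tori and plane pairs);
* `cruxAt_iff_shapeFree`, `femtoCurvatureTwoPoint_iff_shapeFree` — hence the crux body, at fixed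
  data and globally, is LITERALLY EQUIVALENT to the eventual shape-free bounds (the hypothesis `H` of
  `RateFree.cruxAt_of_shapeFree`, verbatim);
* `femtoCurvatureTwoPoint_iff_crossTorus_pairDomination` — and, strict positivity being a theorem
  for every `β > 0` (`StrictRP.cruxAxisCov_pos`, strict Osterwalder–Seiler positivity of the transfer
  matrix of a faithful representation), the typed item is equivalent to the CONJUNCTION OF ITS TWO
  OPEN REGISTERED STUBS `stub_crossTorus ∧ stub_pairDomination` (signatures verbatim).

Consequences recorded for the planner (nothing here is asserted beyond what is proved): the typed item
has exactly the content "cross-torus comparability + pair domination of fixed-torus plaquette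
covariances, eventually in `β`, one constant" — a fixed-torus (`β → ∞` at fixed `L`) statement with no
ultraviolet content; its honest residue is the fixed-torus semiclassics feeding those two stubs
(`SemiclassicalLimits`, `…TwoPointDefsDU`, bridge `femtoCurvatureTwoPoint_of_limits`), and it is
implied by the C′ crux `FemtoCurvatureTwoPointC` (stmt-QuantumFields-16204, edge
`femtoCurvatureTwoPoint_of_C`).
-/

set_option autoImplicit false

noncomputable section

open Filter Topology MeasureTheory
open Literature.MathematicalPhysics.QuantumFieldTheory
open Summit.QuantumFields.YangMills.Cruxes.FemtoCurvatureTwoPoint.GenericStepGammaEncoding (CruxAt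
  femtoCurvatureTwoPoint_iff_cruxAt)

namespace Summit.QuantumFields.YangMills.Theorems.FemtoCurvatureTwoPoint.RateFree

/-- **Dissection (necessary half) at fixed data.** Any witness of the crux body `CruxAt r` forces the
eventual shape-free bounds with `K = C / c`: for every ceiling `L₀` there is a threshold beyond which,
on all tori `L, L' ≤ L₀` and all `1 ≤ n ≤ L / 8`, the reference axis covariance on `L` is strictly
positive, the one on `L'` (if `8 n ≤ L'`) is at most `K` times it, and every plaquette pair of `L'` at
torus distance `n` is at most `K` times it in absolute value. Mechanism: `a → 0` makes every torus of
side `≤ L₀` femto at all large `β`; the lower bound pins `c Γ(n a(β)) ≤ n⁸ Cov_L`, the upper bounds give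
`n⁸ Cov_{L'} ≤ C Γ(n a(β))` and `|Cov_{L'}(pair)| n⁸ ≤ C Γ(n a(β))` at the SAME argument of `Γ`. [folklore] -/
theorem shapeFree_of_cruxAt {G : Type} [Group G] [TopologicalSpace G] [IsTopologicalGroup G]
    [CompactSpace G] [MeasurableSpace G] [BorelSpace G] (r : LatticeRep G) (h : CruxAt r) :
    ∃ K : ℝ, 0 < K ∧ ∀ L₀ : ℕ, ∃ T : ℝ, ∀ β : ℝ, T ≤ β → ∀ (L L' : ℕ) [NeZero L] [NeZero L'] (n : ℕ), 1 ≤ n → 8 * n ≤ L → L ≤ L₀ → L' ≤ L₀ → 0 < wilsonExpectation r.ρ β (fun U : GaugeConfig 4 L G => ((r.N : ℝ) - (r.ρ (plaquetteHolonomy U 0 0 1)).trace.re) * ((r.N : ℝ) - (r.ρ (plaquetteHolonomy U (Pi.single (2 : Fin 4) ((n : ℕ) : ZMod L)) 0 1)).trace.re)) - wilsonExpectation r.ρ β (fun U : GaugeConfig 4 L G => (r.N : ℝ) - (r.ρ (plaquetteHolonomy U 0 0 1)).trace.re) * wilsonExpectation r.ρ β (fun U : GaugeConfig 4 L G => (r.N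 : ℝ) - (r.ρ (plaquetteHolonomy U (Pi.single (2 : Fin 4) ((n : ℕ) : ZMod L)) 0 1)).trace.re) ∧ (8 * n ≤ L' → wilsonExpectation r.ρ β (fun U : GaugeConfig 4 L' G => ((r.N : ℝ) - (r.ρ (plaquetteHolonomy U 0 0 1)).trace.re) * ((r.N : ℝ) - (r.ρ (plaquetteHolonomy U (Pi.single (2 : Fin 4) ((n : ℕ) : ZMod L')) 0 1)).trace.re)) - wilsonExpectation r.ρ β (fun U : GaugeConfig 4 L' G => (r.N : ℝ) - (r.ρ (plaquetteHolonomy U 0 0 1)).trace.re) * wilsonExpectation r.ρ β (fun U : GaugeConfig 4 L' G => (r.N : ℝ) - (r.ρ (plaquetteHolonomy U (Pi.single (2 : Fin 4) ((n : ℕ) : ZMod L')) 0 1)).trace.re) ≤ K * (wilsonExpectation r.ρ β (fun U : GaugeConfig 4 L G => ((r.N : ℝ) - (r.ρ (plaquetteHolonomy U 0 0 1)).trace.re) * ((r.N : ℝ) - (r.ρ (plaquetteHolonomy U (Pi.single (2 : Fin 4) ((n : ℕ) : ZMod L)) 0 1)).trace.re)) - wilsonExpectation r.ρ β (fun U : GaugeConfig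 4 L G => (r.N : ℝ) - (r.ρ (plaquetteHolonomy U 0 0 1)).trace.re) * wilsonExpectation r.ρ β (fun U : GaugeConfig 4 L G => (r.N : ℝ) - (r.ρ (plaquetteHolonomy U (Pi.single (2 : Fin 4) ((n : ℕ) : ZMod L)) 0 1)).trace.re))) ∧ ∀ (x y : Fin 4 → ZMod L') (i j i' j' : Fin 4), x ≠ y → i ≠ j → i' ≠ j' → Real.sqrt (∑ k : Fin 4, (((x k - y k).valMinAbs : ℤ) : ℝ) ^ 2) = n → |wilsonExpectation r.ρ β (fun U : GaugeConfig 4 L' G => ((r.N : ℝ) - (r.ρ (plaquetteHolonomy U x i j)).trace.re) * ((r.N : ℝ) - (r.ρ (plaquetteHolonomy U y i' j')).trace.re)) - wilsonExpectation r.ρ β (fun U : GaugeConfig 4 L' G => (r.N : ℝ) - (r.ρ (plaquetteHolonomy U x i j)).trace.re) * wilsonExpectation r.ρ β (fun U : GaugeConfig 4 L' G => (r.N : ℝ) - (r.ρ (plaquetteHolonomy U y i' j')).trace.re)| ≤ K * (wilsonExpectation r.ρ β (fun U : GaugeConfig 4 L G => ((r.N : ℝ) - (r.ρ (plaquetteHolonomy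 U 0 0 1)).trace.re) * ((r.N : ℝ) - (r.ρ (plaquetteHolonomy U (Pi.single (2 : Fin 4) ((n : ℕ) : ZMod L)) 0 1)).trace.re)) - wilsonExpectation r.ρ β (fun U : GaugeConfig 4 L G => (r.N : ℝ) - (r.ρ (plaquetteHolonomy U 0 0 1)).trace.re) * wilsonExpectation r.ρ β (fun U : GaugeConfig 4 L G => (r.N : ℝ) - (r.ρ (plaquetteHolonomy U (Pi.single (2 : Fin 4) ((n : ℕ) : ZMod L)) 0 1)).trace.re)) := by
  classical
  -- the covariance functional (junk `0` on the empty torus `L = 0`), as in `cruxAt_of_shapeFree`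
  let Φ : (L : ℕ) → ℝ → (Fin 4 → ZMod L) → Fin 4 → Fin 4 → (Fin 4 → ZMod L) → Fin 4 → Fin 4 → ℝ :=
    fun L β x i j y i' j' =>
      if hL : L = 0 then 0 else
        haveI : NeZero L := ⟨hL⟩
        wilsonExpectation (d := 4) (L := L) r.ρ β (fun U : GaugeConfig 4 L G =>
            ((r.N : ℝ) - (r.ρ (plaquetteHolonomy U x i j)).trace.re) *
              ((r.N : ℝ) - (r.ρ (plaquetteHolonomy U y i' j')).trace.re)) -
          wilsonExpectation (d := 4) (L := L) r.ρ β (fun U : GaugeConfig 4 L G =>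
              (r.N : ℝ) - (r.ρ (plaquetteHolonomy U x i j)).trace.re) *
            wilsonExpectation (d := 4) (L := L) r.ρ β (fun U : GaugeConfig 4 L G =>
              (r.N : ℝ) - (r.ρ (plaquetteHolonomy U y i' j')).trace.re)
  have hΦ : ∀ (L : ℕ) [NeZero L] (β : ℝ) (x : Fin 4 → ZMod L) (i j : Fin 4) (y : Fin 4 → ZMod L)
      (i' j' : Fin 4), Φ L β x i j y i' j' =
      wilsonExpectation (d := 4) (L := L) r.ρ β (fun U : GaugeConfig 4 L G =>
            ((r.N : ℝ) - (r.ρ (plaquetteHolonomy U x i j)).trace.re) *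
              ((r.N : ℝ) - (r.ρ (plaquetteHolonomy U y i' j')).trace.re)) -
          wilsonExpectation (d := 4) (L := L) r.ρ β (fun U : GaugeConfig 4 L G =>
              (r.N : ℝ) - (r.ρ (plaquetteHolonomy U x i j)).trace.re) *
            wilsonExpectation (d := 4) (L := L) r.ρ β (fun U : GaugeConfig 4 L G =>
              (r.N : ℝ) - (r.ρ (plaquetteHolonomy U y i' j')).trace.re) := by
    intro L _ β x i j y i' j'
    simp only [Φ, dif_neg (NeZero.ne L)]
  obtain ⟨a, Γ, β₀, ℓ₀, c, C, hℓ, hc, ha, hat, hΓ, hcl⟩ := h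
  -- the two clauses of the crux, spelled through `Φ`
  have hAx : ∀ (L : ℕ) [NeZero L] (β : ℝ), β₀ ≤ β → (L : ℝ) * a β ≤ ℓ₀ → ∀ n : ℕ, 1 ≤ n → 8 * n ≤ L →
      c * Γ ((n : ℝ) * a β) ≤ (n : ℝ) ^ 8 * Φ L β 0 0 1 (Pi.single (2 : Fin 4) ((n : ℕ) : ZMod L)) 0 1 ∧
        (n : ℝ) ^ 8 * Φ L β 0 0 1 (Pi.single (2 : Fin 4) ((n : ℕ) : ZMod L)) 0 1 ≤ C * Γ ((n : ℝ) * a β) := by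
    intro L _ β hβ hLa n hn hnL
    obtain ⟨h1, -⟩ := hcl L β hβ hLa
    rw [hΦ]
    exact h1 n hn hnL
  have hPr : ∀ (L : ℕ) [NeZero L] (β : ℝ), β₀ ≤ β → (L : ℝ) * a β ≤ ℓ₀ →
      ∀ (x y : Fin 4 → ZMod L) (i j i' j' : Fin 4), x ≠ y → i ≠ j → i' ≠ j' →
        |Φ L β x i j y i' j'| * Real.sqrt (∑ k : Fin 4, (((x k - y k).valMinAbs : ℤ) : ℝ) ^ 2) ^ 8 ≤
          C * Γ (Real.sqrt (∑ k : Fin 4, (((x k - y k).valMinAbs : ℤ) : ℝ) ^ 2) * a β) := by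
    intro L _ β hβ hLa x y i j i' j' hxy hij hij'
    obtain ⟨-, h2⟩ := hcl L β hβ hLa
    rw [hΦ]
    exact h2 x y i j i' j' hxy hij hij'
  -- every torus of side `≤ L₀` is eventually femto
  have hfemto : ∀ L₀ : ℕ, ∀ᶠ β in atTop, β₀ ≤ β ∧ (L₀ : ℝ) * a β ≤ ℓ₀ := by
    intro L₀
    have h2 : ∀ᶠ β in atTop, a β < ℓ₀ / ((L₀ : ℝ) + 1) :=
      hat (Iio_mem_nhds (div_pos hℓ (by positivity)))
    filter_upwards [eventually_ge_atTop β₀, h2] with β hβ hβ'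
    refine ⟨hβ, ?_⟩
    have h3 : a β * ((L₀ : ℝ) + 1) < ℓ₀ := (lt_div_iff₀ (by positivity)).1 hβ'
    nlinarith [ha β]
  -- `c ≤ C` (lower ≤ upper on the torus `L = 8`, eventually femto)
  have hcC : c ≤ C := by
    haveI : NeZero (8 : ℕ) := ⟨by norm_num⟩
    obtain ⟨β, hβ₀, h8⟩ := (hfemto 8).exists
    have ha1 : 0 < ((1 : ℕ) : ℝ) * a β := by simpa using ha β
    have ha1' : ((1 : ℕ) : ℝ) * a β ≤ ℓ₀ := by
      have h8' : ((8 : ℕ) : ℝ) * a β ≤ ℓ₀ := h8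
      push_cast at h8' ⊢
      nlinarith [ha β]
    obtain ⟨h1, h2⟩ := hAx 8 β hβ₀ h8 1 le_rfl (by norm_num)
    exact le_of_mul_le_mul_right (h1.trans h2) (hΓ _ ha1 ha1').1
  have hC : 0 ≤ C := hc.le.trans hcC
  refine ⟨C / c, div_pos (hc.trans_le hcC) hc, fun L₀ => ?_⟩
  obtain ⟨T, hT⟩ := Filter.eventually_atTop.mp (hfemto L₀)
  refine ⟨T, fun β hβ L L' _ _ n hn hnL hLL₀ hL'L₀ => ?_⟩
  obtain ⟨hβ₀, hL₀a⟩ := hT β hβ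
  have haβ := (ha β).le
  have hLa : (L : ℝ) * a β ≤ ℓ₀ :=
    (mul_le_mul_of_nonneg_right (Nat.cast_le.2 hLL₀) haβ).trans hL₀a
  have hL'a : (L' : ℝ) * a β ≤ ℓ₀ :=
    (mul_le_mul_of_nonneg_right (Nat.cast_le.2 hL'L₀) haβ).trans hL₀a
  have hn' : (0 : ℝ) < n := by exact_mod_cast hn
  have hs : 0 < (n : ℝ) * a β ∧ (n : ℝ) * a β ≤ ℓ₀ :=
    ⟨mul_pos hn' (ha β), (mul_le_mul_of_nonneg_right
      (show (n : ℝ) ≤ L by exact_mod_cast (by omega : n ≤ L)) haβ).trans hLa⟩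
  have hΓpos : 0 < Γ ((n : ℝ) * a β) := (hΓ _ hs.1 hs.2).1
  have hn8 : (0 : ℝ) < (n : ℝ) ^ 8 := by positivity
  obtain ⟨hlow, -⟩ := hAx L β hβ₀ hLa n hn hnL
  -- the three shape-free clauses, through `Φ`
  have key : 0 < Φ L β 0 0 1 (Pi.single (2 : Fin 4) ((n : ℕ) : ZMod L)) 0 1 ∧
      (8 * n ≤ L' → Φ L' β 0 0 1 (Pi.single (2 : Fin 4) ((n : ℕ) : ZMod L')) 0 1 ≤
        C / c * Φ L β 0 0 1 (Pi.single (2 : Fin 4) ((n : ℕ) : ZMod L)) 0 1) ∧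
      ∀ (x y : Fin 4 → ZMod L') (i j i' j' : Fin 4), x ≠ y → i ≠ j → i' ≠ j' →
        Real.sqrt (∑ k : Fin 4, (((x k - y k).valMinAbs : ℤ) : ℝ) ^ 2) = n →
          |Φ L' β x i j y i' j'| ≤ C / c * Φ L β 0 0 1 (Pi.single (2 : Fin 4) ((n : ℕ) : ZMod L)) 0 1 := by
    set A := Φ L β 0 0 1 (Pi.single (2 : Fin 4) ((n : ℕ) : ZMod L)) 0 1 with hA
    have hcΓ : 0 < c * Γ ((n : ℝ) * a β) := mul_pos hc hΓpos
    have hApos : 0 < A := by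
      by_contra hneg
      have hneg' : A ≤ 0 := not_lt.1 hneg
      nlinarith [mul_nonpos_of_nonneg_of_nonpos hn8.le hneg']
    refine ⟨hApos, fun hnL' => ?_, fun x y i j i' j' hxy hij hij' hd => ?_⟩
    · obtain ⟨-, hup⟩ := hAx L' β hβ₀ hL'a n hn hnL'
      -- `c · n⁸ Cov_{L'} ≤ c · C Γ = C · (c Γ) ≤ C · n⁸ A`
      have key' : c * ((n : ℝ) ^ 8 * Φ L' β 0 0 1 (Pi.single (2 : Fin 4) ((n : ℕ) : ZMod L')) 0 1) ≤
          C * ((n : ℝ) ^ 8 * A) :=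
        calc c * ((n : ℝ) ^ 8 * Φ L' β 0 0 1 (Pi.single (2 : Fin 4) ((n : ℕ) : ZMod L')) 0 1)
              ≤ c * (C * Γ ((n : ℝ) * a β)) := mul_le_mul_of_nonneg_left hup hc.le
          _ = C * (c * Γ ((n : ℝ) * a β)) := by ring
          _ ≤ C * ((n : ℝ) ^ 8 * A) := mul_le_mul_of_nonneg_left hlow hC
      rw [div_mul_eq_mul_div, le_div_iff₀ hc]
      refine le_of_mul_le_mul_left ?_ hn8
      nlinarith
    · have hp := hPr L' β hβ₀ hL'a x y i j i' j' hxy hij hij'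
      rw [hd] at hp
      -- `|Cov_{L'}(pair)| n⁸ ≤ C Γ ≤ (C/c) · n⁸ A`
      have h3 : C * Γ ((n : ℝ) * a β) ≤ C / c * ((n : ℝ) ^ 8 * A) := by
        rw [div_mul_eq_mul_div, le_div_iff₀ hc]
        nlinarith
      refine le_of_mul_le_mul_right ?_ hn8
      nlinarith [abs_nonneg (Φ L' β x i j y i' j')]
  simp only [hΦ] at key
  exact key

/-- **The crux body at fixed data is EQUIVALENT to the eventual shape-free bounds** (both directions
kernel-checked: `cruxAt_of_shapeFree`, the rate-free generic-step encoding, and `shapeFree_of_cruxAt`,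
the dissection). [folklore] -/
theorem cruxAt_iff_shapeFree {G : Type} [Group G] [TopologicalSpace G] [IsTopologicalGroup G]
    [CompactSpace G] [MeasurableSpace G] [BorelSpace G] (r : LatticeRep G) :
    CruxAt r ↔ ∃ K : ℝ, 0 < K ∧ ∀ L₀ : ℕ, ∃ T : ℝ, ∀ β : ℝ, T ≤ β → ∀ (L L' : ℕ) [NeZero L] [NeZero L'] (n : ℕ), 1 ≤ n → 8 * n ≤ L → L ≤ L₀ → L' ≤ L₀ → 0 < wilsonExpectation r.ρ β (fun U : GaugeConfig 4 L G => ((r.N : ℝ) - (r.ρ (plaquetteHolonomy U 0 0 1)).trace.re) * ((r.N : ℝ) - (r.ρ (plaquetteHolonomy U (Pi.single (2 : Fin 4) ((n : ℕ) : ZMod L)) 0 1)).trace.re)) - wilsonExpectation r.ρ β (fun U : GaugeConfig 4 L G => (r.N : ℝ) - (r.ρ (plaquetteHolonomy U 0 0 1)).trace.re) * wilsonExpectation r.ρ β (fun U : GaugeConfig 4 L G => (r.N : ℝ) - (r.ρ (plaquetteHolonomy U (Pi.single (2 : Fin 4) ((n : ℕ) : ZMod L)) 0 1)).trace.re) ∧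 (8 * n ≤ L' → wilsonExpectation r.ρ β (fun U : GaugeConfig 4 L' G => ((r.N : ℝ) - (r.ρ (plaquetteHolonomy U 0 0 1)).trace.re) * ((r.N : ℝ) - (r.ρ (plaquetteHolonomy U (Pi.single (2 : Fin 4) ((n : ℕ) : ZMod L')) 0 1)).trace.re)) - wilsonExpectation r.ρ β (fun U : GaugeConfig 4 L' G => (r.N : ℝ) - (r.ρ (plaquetteHolonomy U 0 0 1)).trace.re) * wilsonExpectation r.ρ β (fun U : GaugeConfig 4 L' G => (r.N : ℝ) - (r.ρ (plaquetteHolonomy U (Pi.single (2 : Fin 4) ((n : ℕ) : ZMod L')) 0 1)).trace.re) ≤ K * (wilsonExpectation r.ρ β (fun U : GaugeConfig 4 L G => ((r.N : ℝ) - (r.ρ (plaquetteHolonomy U 0 0 1)).trace.re) * ((r.N : ℝ) - (r.ρ (plaquetteHolonomy U (Pi.single (2 : Fin 4) ((n : ℕ) : ZMod L)) 0 1)).trace.re)) - wilsonExpectation r.ρ β (fun U : GaugeConfig 4 L G => (r.N : ℝ) - (r.ρ (plaquetteHolonomy U 0 0 1)).trace.re) * wilsonExpectation r.ρ β (fun U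 : GaugeConfig 4 L G => (r.N : ℝ) - (r.ρ (plaquetteHolonomy U (Pi.single (2 : Fin 4) ((n : ℕ) : ZMod L)) 0 1)).trace.re))) ∧ ∀ (x y : Fin 4 → ZMod L') (i j i' j' : Fin 4), x ≠ y → i ≠ j → i' ≠ j' → Real.sqrt (∑ k : Fin 4, (((x k - y k).valMinAbs : ℤ) : ℝ) ^ 2) = n → |wilsonExpectation r.ρ β (fun U : GaugeConfig 4 L' G => ((r.N : ℝ) - (r.ρ (plaquetteHolonomy U x i j)).trace.re) * ((r.N : ℝ) - (r.ρ (plaquetteHolonomy U y i' j')).trace.re)) - wilsonExpectation r.ρ β (fun U : GaugeConfig 4 L' G => (r.N : ℝ) - (r.ρ (plaquetteHolonomy U x i j)).trace.re) * wilsonExpectation r.ρ β (fun U : GaugeConfig 4 L' G => (r.N : ℝ) - (r.ρ (plaquetteHolonomy U y i' j')).trace.re)| ≤ K * (wilsonExpectation r.ρ β (fun U : GaugeConfig 4 L G => ((r.N : ℝ) - (r.ρ (plaquetteHolonomy U 0 0 1)).trace.re) * ((r.N : ℝ) - (r.ρ (plaquetteHolonomy U (Pi.single (2 : Fin 4) ((n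 : ℕ) : ZMod L)) 0 1)).trace.re)) - wilsonExpectation r.ρ β (fun U : GaugeConfig 4 L G => (r.N : ℝ) - (r.ρ (plaquetteHolonomy U 0 0 1)).trace.re) * wilsonExpectation r.ρ β (fun U : GaugeConfig 4 L G => (r.N : ℝ) - (r.ρ (plaquetteHolonomy U (Pi.single (2 : Fin 4) ((n : ℕ) : ZMod L)) 0 1)).trace.re)) :=
  ⟨shapeFree_of_cruxAt r, cruxAt_of_shapeFree r⟩

/-- **The typed item is EQUIVALENT to the eventual shape-free bounds at every `(G, r)`** — the exact
content of `FemtoCurvatureTwoPoint` (stmt-QuantumFields-9363) as typed: a fixed-torus, rate-free,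
scale-free statement (`→`: `shapeFree_of_cruxAt` after `borelize`; `←`: the landed
`femtoCurvatureTwoPoint_of_shapeFree`). [folklore] -/
theorem femtoCurvatureTwoPoint_iff_shapeFree :
    Summit.QuantumFields.YangMills.Theses.LangevinControlUV.FemtoCurvatureTwoPoint ↔ ∀ (G : Type) [Group G] [TopologicalSpace G] [IsTopologicalGroup G] [CompactSpace G] [MeasurableSpace G] [BorelSpace G], IsCompactSimpleLieGroup G → ∀ r : LatticeRep G, ∃ K : ℝ, 0 < K ∧ ∀ L₀ : ℕ, ∃ T : ℝ, ∀ β : ℝ, T ≤ β → ∀ (L L' : ℕ) [NeZero L] [NeZero L'] (n : ℕ), 1 ≤ n → 8 * n ≤ L → L ≤ L₀ → L' ≤ L₀ → 0 < wilsonExpectation r.ρ β (fun U : GaugeConfig 4 L G => ((r.N : ℝ) - (r.ρ (plaquetteHolonomy U 0 0 1)).trace.re) * ((r.N : ℝ) - (r.ρ (plaquetteHolonomy U (Pi.single (2 : Fin 4) ((n : ℕ) : ZMod L)) 0 1)).trace.re)) - wilsonExpectation r.ρ β (fun U : GaugeConfig 4 L G => (r.N : ℝ) - (r.ρ (plaquetteHolonomy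 U 0 0 1)).trace.re) * wilsonExpectation r.ρ β (fun U : GaugeConfig 4 L G => (r.N : ℝ) - (r.ρ (plaquetteHolonomy U (Pi.single (2 : Fin 4) ((n : ℕ) : ZMod L)) 0 1)).trace.re) ∧ (8 * n ≤ L' → wilsonExpectation r.ρ β (fun U : GaugeConfig 4 L' G => ((r.N : ℝ) - (r.ρ (plaquetteHolonomy U 0 0 1)).trace.re) * ((r.N : ℝ) - (r.ρ (plaquetteHolonomy U (Pi.single (2 : Fin 4) ((n : ℕ) : ZMod L')) 0 1)).trace.re)) - wilsonExpectation r.ρ β (fun U : GaugeConfig 4 L' G => (r.N : ℝ) - (r.ρ (plaquetteHolonomy U 0 0 1)).trace.re) * wilsonExpectation r.ρ β (fun U : GaugeConfig 4 L' G => (r.N : ℝ) - (r.ρ (plaquetteHolonomy U (Pi.single (2 : Fin 4) ((n : ℕ) : ZMod L')) 0 1)).trace.re) ≤ K * (wilsonExpectation r.ρ β (fun U : GaugeConfig 4 L G => ((r.N : ℝ) - (r.ρ (plaquetteHolonomy U 0 0 1)).trace.re) * ((r.N : ℝ) - (r.ρ (plaquetteHolonomy U (Pi.single (2 : Fin 4)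 ((n : ℕ) : ZMod L)) 0 1)).trace.re)) - wilsonExpectation r.ρ β (fun U : GaugeConfig 4 L G => (r.N : ℝ) - (r.ρ (plaquetteHolonomy U 0 0 1)).trace.re) * wilsonExpectation r.ρ β (fun U : GaugeConfig 4 L G => (r.N : ℝ) - (r.ρ (plaquetteHolonomy U (Pi.single (2 : Fin 4) ((n : ℕ) : ZMod L)) 0 1)).trace.re))) ∧ ∀ (x y : Fin 4 → ZMod L') (i j i' j' : Fin 4), x ≠ y → i ≠ j → i' ≠ j' → Real.sqrt (∑ k : Fin 4, (((x k - y k).valMinAbs : ℤ) : ℝ) ^ 2) = n → |wilsonExpectation r.ρ β (fun U : GaugeConfig 4 L' G => ((r.N : ℝ) - (r.ρ (plaquetteHolonomy U x i j)).trace.re) * ((r.N : ℝ) - (r.ρ (plaquetteHolonomy U y i' j')).trace.re)) - wilsonExpectation r.ρ β (fun U : GaugeConfig 4 L' G => (r.N : ℝ) - (r.ρ (plaquetteHolonomy U x i j)).trace.re) * wilsonExpectation r.ρ β (fun U : GaugeConfig 4 L' G => (r.N : ℝ) - (r.ρ (plaquetteHolonomy U y i' j')).trace.re)| ≤ K * (wilsonExpectation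 r.ρ β (fun U : GaugeConfig 4 L G => ((r.N : ℝ) - (r.ρ (plaquetteHolonomy U 0 0 1)).trace.re) * ((r.N : ℝ) - (r.ρ (plaquetteHolonomy U (Pi.single (2 : Fin 4) ((n : ℕ) : ZMod L)) 0 1)).trace.re)) - wilsonExpectation r.ρ β (fun U : GaugeConfig 4 L G => (r.N : ℝ) - (r.ρ (plaquetteHolonomy U 0 0 1)).trace.re) * wilsonExpectation r.ρ β (fun U : GaugeConfig 4 L G => (r.N : ℝ) - (r.ρ (plaquetteHolonomy U (Pi.single (2 : Fin 4) ((n : ℕ) : ZMod L)) 0 1)).trace.re)) := by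
  refine ⟨fun h G _ _ _ _ _ _ hG r => ?_, femtoCurvatureTwoPoint_of_shapeFree⟩
  borelize G
  rw [femtoCurvatureTwoPoint_iff_cruxAt] at h
  exact shapeFree_of_cruxAt r (h G hG r)

/-- **The typed item is EQUIVALENT to the conjunction of its two open registered stubs**
`stub_crossTorus ∧ stub_pairDomination` of the rate-free skeleton of line `generic-step-gamma-encoding`
(lead c3, reshape 4; signatures verbatim). `→`: the two stubs are two of the three shape-free clauses;
`←`: the third clause, strict positivity of the reference axis covariance, is a THEOREM for every
`β > 0`, every torus `L ≥ 4` and every `1 ≤ n ≤ L − 1` (`StrictRP.cruxAxisCov_pos`: compact simple Lie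
groups are non-trivial and `r` is faithful), so thresholds `max (T₁ L₀) (T₂ L₀) ⊔ 1` and the constant
`max K₁ K₂` serve. So settling stmt-QuantumFields-9363 is EXACTLY settling these two fixed-torus
statements (cross-torus comparability and pair domination, eventually in `β`, one constant). [folklore] -/
theorem femtoCurvatureTwoPoint_iff_crossTorus_pairDomination :
    Summit.QuantumFields.YangMills.Theses.LangevinControlUV.FemtoCurvatureTwoPoint ↔ ((∀ (G : Type) [Group G] [TopologicalSpace G] [IsTopologicalGroup G] [CompactSpace G] [MeasurableSpace G] [BorelSpace G], IsCompactSimpleLieGroup G → ∀ (r : LatticeRep G), ∃ K : ℝ, 0 < K ∧ ∀ L₀ : ℕ, ∃ T : ℝ, ∀ β : ℝ, T ≤ β → ∀ (L L' : ℕ) [NeZero L] [NeZero L'] (n : ℕ), 1 ≤ n → 8 * n ≤ L → 8 * n ≤ L' → L ≤ L₀ → L' ≤ L₀ → wilsonExpectation r.ρ β (fun U : GaugeConfig 4 L' G => ((r.N : ℝ) - (r.ρ (plaquetteHolonomy U 0 0 1)).trace.re) * ((r.N : ℝ) - (r.ρ (plaquetteHolonomy U (Pi.single (2 : Fin 4)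 ((n : ℕ) : ZMod L')) 0 1)).trace.re)) - wilsonExpectation r.ρ β (fun U : GaugeConfig 4 L' G => (r.N : ℝ) - (r.ρ (plaquetteHolonomy U 0 0 1)).trace.re) * wilsonExpectation r.ρ β (fun U : GaugeConfig 4 L' G => (r.N : ℝ) - (r.ρ (plaquetteHolonomy U (Pi.single (2 : Fin 4) ((n : ℕ) : ZMod L')) 0 1)).trace.re) ≤ K * (wilsonExpectation r.ρ β (fun U : GaugeConfig 4 L G => ((r.N : ℝ) - (r.ρ (plaquetteHolonomy U 0 0 1)).trace.re) * ((r.N : ℝ) - (r.ρ (plaquetteHolonomy U (Pi.single (2 : Fin 4) ((n : ℕ) : ZMod L)) 0 1)).trace.re)) - wilsonExpectation r.ρ β (fun U : GaugeConfig 4 L G => (r.N : ℝ) - (r.ρ (plaquetteHolonomy U 0 0 1)).trace.re) * wilsonExpectation r.ρ β (fun U : GaugeConfig 4 L G => (r.N : ℝ) - (r.ρ (plaquetteHolonomy U (Pi.single (2 : Fin 4) ((n : ℕ) : ZMod L)) 0 1)).trace.re))) ∧ (∀ (G : Type) [Group G] [TopologicalSpace G] [IsTopologicalGroup G] [CompactSpace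 G] [MeasurableSpace G] [BorelSpace G], IsCompactSimpleLieGroup G → ∀ (r : LatticeRep G), ∃ K : ℝ, 0 < K ∧ ∀ L₀ : ℕ, ∃ T : ℝ, ∀ β : ℝ, T ≤ β → ∀ (L L' : ℕ) [NeZero L] [NeZero L'] (n : ℕ) (x y : Fin 4 → ZMod L') (i j i' j' : Fin 4), 1 ≤ n → 8 * n ≤ L → L ≤ L₀ → L' ≤ L₀ → x ≠ y → i ≠ j → i' ≠ j' → Real.sqrt (∑ k : Fin 4, (((x k - y k).valMinAbs : ℤ) : ℝ) ^ 2) = n → |wilsonExpectation r.ρ β (fun U : GaugeConfig 4 L' G => ((r.N : ℝ) - (r.ρ (plaquetteHolonomy U x i j)).trace.re) * ((r.N : ℝ) - (r.ρ (plaquetteHolonomy U y i' j')).trace.re)) - wilsonExpectation r.ρ β (fun U : GaugeConfig 4 L' G => (r.N : ℝ) - (r.ρ (plaquetteHolonomy U x i j)).trace.re) * wilsonExpectation r.ρ β (fun U : GaugeConfig 4 L' G => (r.N : ℝ) - (r.ρ (plaquetteHolonomy U y i' j')).trace.re)| ≤ K * (wilsonExpectation r.ρ β (fun U : GaugeConfig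 4 L G => ((r.N : ℝ) - (r.ρ (plaquetteHolonomy U 0 0 1)).trace.re) * ((r.N : ℝ) - (r.ρ (plaquetteHolonomy U (Pi.single (2 : Fin 4) ((n : ℕ) : ZMod L)) 0 1)).trace.re)) - wilsonExpectation r.ρ β (fun U : GaugeConfig 4 L G => (r.N : ℝ) - (r.ρ (plaquetteHolonomy U 0 0 1)).trace.re) * wilsonExpectation r.ρ β (fun U : GaugeConfig 4 L G => (r.N : ℝ) - (r.ρ (plaquetteHolonomy U (Pi.single (2 : Fin 4) ((n : ℕ) : ZMod L)) 0 1)).trace.re)))) := by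
  rw [femtoCurvatureTwoPoint_iff_shapeFree]
  constructor
  · intro h
    refine ⟨fun G _ _ _ _ _ _ hG r => ?_, fun G _ _ _ _ _ _ hG r => ?_⟩
    · obtain ⟨K, hK, hL₀⟩ := h G hG r
      refine ⟨K, hK, fun L₀ => ?_⟩
      obtain ⟨T, hT⟩ := hL₀ L₀
      refine ⟨T, fun β hβ L L' _ _ n hn hnL hnL' hLL₀ hL'L₀ => ?_⟩
      exact (hT β hβ L L' n hn hnL hLL₀ hL'L₀).2.1 hnL'
    · obtain ⟨K, hK, hL₀⟩ := h G hG r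
      refine ⟨K, hK, fun L₀ => ?_⟩
      obtain ⟨T, hT⟩ := hL₀ L₀
      refine ⟨T, fun β hβ L L' _ _ n x y i j i' j' hn hnL hLL₀ hL'L₀ hxy hij hij' hd => ?_⟩
      exact (hT β hβ L L' n hn hnL hLL₀ hL'L₀).2.2 x y i j i' j' hxy hij hij' hd
  · rintro ⟨hCT, hPD⟩ G _ _ _ _ _ _ hG r
    obtain ⟨K₁, hK₁, h₁⟩ := hCT G hG r
    obtain ⟨K₂, hK₂, h₂⟩ := hPD G hG r
    refine ⟨max K₁ K₂, lt_max_of_lt_left hK₁, fun L₀ => ?_⟩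
    obtain ⟨T₁, hT₁⟩ := h₁ L₀
    obtain ⟨T₂, hT₂⟩ := h₂ L₀
    refine ⟨max (max T₁ T₂) 1, fun β hβ L L' _ _ n hn hnL hLL₀ hL'L₀ => ?_⟩
    have hβ₁ : T₁ ≤ β := ((le_max_left _ _).trans (le_max_left _ _)).trans hβ
    have hβ₂ : T₂ ≤ β := ((le_max_right _ _).trans (le_max_left _ _)).trans hβ
    have hβpos : 0 < β := one_pos.trans_le ((le_max_right _ _).trans hβ)
    have hpos : 0 < wilsonExpectation r.ρ β (fun U : GaugeConfig 4 L G => ((r.N : ℝ) - (r.ρ (plaquetteHolonomy U 0 0 1)).trace.re) * ((r.N : ℝ) - (r.ρ (plaquetteHolonomy U (Pi.single (2 : Fin 4) ((n : ℕ) : ZMod L)) 0 1)).trace.re)) - wilsonExpectation r.ρ β (fun U : GaugeConfig 4 L G => (r.N : ℝ) - (r.ρ (plaquetteHolonomy U 0 0 1)).trace.re) * wilsonExpectation r.ρ β (fun U : GaugeConfig 4 L G => (r.N : ℝ) - (r.ρ (plaquetteHolonomy U (Pi.single (2 : Fin 4) ((n : ℕ) : ZMod L)) 0 1)).trace.re)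 :=
      StrictRP.cruxAxisCov_pos (L := L) r.ρ (by omega) r.continuous r.injective r.mem_unitary
        (StrictRP.exists_ne_one_of_isCompactSimpleLieGroup hG) hβpos hn (by omega)
    refine ⟨hpos, fun hnL' => ?_, fun x y i j i' j' hxy hij hij' hd => ?_⟩
    · exact (hT₁ β hβ₁ L L' n hn hnL hnL' hLL₀ hL'L₀).trans
        (mul_le_mul_of_nonneg_right (le_max_left _ _) hpos.le)
    · exact (hT₂ β hβ₂ L L' n x y i j i' j' hn hnL hLL₀ hL'L₀ hxy hij hij' hd).trans
        (mul_le_mul_of_nonneg_right (le_max_right _ _) hpos.le)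

end Summit.QuantumFields.YangMills.Theorems.FemtoCurvatureTwoPoint.RateFree

end
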